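import Summits.RiemannHypothesis.RiemannHypothesis.Theorems.TiltedLandingLaw421R3SinkTemplate
import Literature.Analysis.Complex.HarmonicMaxPrinciple

/-!
# W-08 · ⟨33346⟩ `TiltedLandingLaw421R`, regime 3′ — «SinkLemmaH»: KERNEL PROOF of `RhW08.SinkTemplate.LemmaHSig` (token 104)

C1 «words / typing / kernel» desk (rh-idea-5 g39), IMAGE-CANDIDATE v1 — files-only (0 kit · 0 registry verbs · 0 proposals); proposed
target `Summits/RiemannHypothesis/RiemannHypothesis/Theorems/TiltedLandingLaw421R3SinkLemmaH.lean`, `--supports stmt-RiemannHypothesis-33346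
--as helper`, level SUPPORT.  TWO imports: the tree module of 102 «SinkTemplate» (C3; ns `RhW08.SinkTemplate`: `Cut`, `farPairK`, `farPairC`,
`cutNumer`, `MaxStrip`, `MaxStripBdry`, `KernelDom`, `KernelDomBdry`, `LemmaHSig`) and `Literature.Analysis.Complex.HarmonicMaxPrinciple`
(`Literature.Analysis.Complex.harmonic_le_of_frontier_of_cocompact`, the Phragmén–Lindelöf-free maximum principle for harmonic functions on an
unbounded open preconnected set with decay along `cocompact ℂ ⊓ 𝓟 U`).  Namespace `RhW08.SinkLemmaH`; nothing of 102 is re-declared.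

WHAT IS PROVED (★ `sinkLemmaH : RhW08.SinkTemplate.LemmaHSig`, C3 memo «TWOPOINT-SINK» §2 Lemma H, verbatim the `def … : Prop` of 102):
for every finite cut family `cs`, every child location `w` and every real `σ`, if `|Re w − xv| < R/2` and every cut point has `|Re p_k − xv| < R/2`
(all poles strictly inside the near window), then KERNEL DOMINATION ON THE BOUNDARY of the maximal far strip
(`KernelDomBdry`: `cutNumer cs w u ≤ σ·farPairC w u` on the inner columns `|Re u − xv| = R/2, |Im u| ≤ R/2` and the lids `|Im u| = R/2,
|Re u − xv| ≥ R/2`) implies KERNEL DOMINATION ON THE WHOLE maximal far strip (`KernelDom`: the same on `R/2 ≤ |Re u − xv|, |Im u| ≤ R/2`).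

HOW (harmonic bookkeeping, no law): §2 `cutNumer cs w u − σ·farPairC w u = Re (sinkGen cs w σ u)` at EVERY `u` (`cutNumer_sub_eq`; both sides use
Lean's `0⁻¹ = 0` at the poles, so the identity is unconditional), where `sinkGen` is a finite sum of `const·(q − u)⁻¹`, `q ∈ {w, w̄, p_k, p̄_k}` — the
conjugate-pole terms rewritten through `c·(z − ū)⁻¹ = conj (c̄·(z̄ − u)⁻¹)`; `sinkGen` is complex-differentiable off the poles, hence analytic at every
FAR point (`sinkGen_analyticAt`, poles strictly near), so its real part is harmonic there (`AnalyticAt.harmonicAt_re`), and `sinkGen → 0` along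
`cocompact ℂ` (`sinkGen_tendsto`).  §1 the maximal far strip minus its boundary is the union of TWO open convex half-strips `sinkHalfStrip xv R (±1)`;
on each, `harmonic_le_of_frontier_of_cocompact` with `M = 0` gives `r ≤ 0` from `r ≤ 0` on the frontier (⊆ `MaxStripBdry`,
`frontier_sinkHalfStrip_subset_bdry`) and `r → 0` at infinity (`nonpos_on_sinkHalfStrip`); boundary points are covered by the hypothesis itself
(`nonpos_on_maxStrip`).  §3 assembles ★.  `0 ≤ R` is forced by `|Re w − xv| < R/2`.

LEVEL: SUPPORT (K).  Asserts no law; `LemmaHSig` is a true classical statement and this file is its kernel proof; it discharges the `LemmaHSig`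
hypothesis of 102's ★ `RhW08.SinkTemplate.sinkAssembly : AssemblySig` (C3), nothing more.  No `sorry`, no new axiom, no `example` / `instance` /
`notation` / `private` / `set_option`.  Nothing here bears on the truth of RH; RH is not proved; ⟨33346⟩/⟨33347⟩ OPEN; socket 3′
`RhW08.NearCoincidentTie.HeavyMassWindowQ (1/2) 1` OPEN; `CornerDominanceSig` / `CertificatesExistSig` of 102 OPEN; checked ≠ keyed ≠ landed ≠ proved.
-/

noncomputable section

open Complex Filter Set Topology InnerProductSpace
open scoped ComplexConjugate
open RhW08.SinkTemplate (Cut farPairK farPairC cutNumer MaxStrip MaxStripBdry KernelDom KernelDomBdry LemmaHSig)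

namespace RhW08.SinkLemmaH

/-! ## §1  The maximum principle on the maximal far strip (abstract harmonic bookkeeping) -/

/-- the OPEN half-strip of the maximal far strip on side `s` (`s = 1`: `Re u > xv + R/2`; `s = -1`: `Re u < xv − R/2`),
`|Im u| < R/2`. -/
def sinkHalfStrip (xv R s : ℝ) : Set ℂ :=
  {v : ℂ | R / 2 < s * (v.re - xv)} ∩ ({v : ℂ | v.im < R / 2} ∩ {v : ℂ | -(R / 2) < v.im})

variable {xv R s : ℝ}

/-- each open half-strip is open (three strict linear inequalities in `Re`, `Im`). -/
theorem isOpen_sinkHalfStrip : IsOpen (sinkHalfStrip xv R s) :=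
  (isOpen_lt continuous_const (continuous_const.mul (Complex.continuous_re.sub continuous_const))).inter
    ((isOpen_lt Complex.continuous_im continuous_const).inter
      (isOpen_lt continuous_const Complex.continuous_im))

/-- each open half-strip (`s = ±1`) is convex: an intersection of three open half-planes. -/
theorem convex_sinkHalfStrip (hs : s = 1 ∨ s = -1) : Convex ℝ (sinkHalfStrip xv R s) := by
  have h1 : Convex ℝ {v : ℂ | R / 2 < s * (v.re - xv)} := by
    rcases hs with rfl | rfl
    · have : {v : ℂ | R / 2 < (1 : ℝ) * (v.re - xv)} = {v : ℂ | xv + R / 2 < v.re} := by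
        ext v; simp only [Set.mem_setOf_eq]; constructor <;> intro h <;> linarith
      rw [this]; exact convex_halfSpace_re_gt _
    · have : {v : ℂ | R / 2 < (-1 : ℝ) * (v.re - xv)} = {v : ℂ | v.re < xv - R / 2} := by
        ext v; simp only [Set.mem_setOf_eq]; constructor <;> intro h <;> linarith
      rw [this]; exact convex_halfSpace_re_lt _
  exact h1.inter ((convex_halfSpace_im_lt _).inter (convex_halfSpace_im_gt _))

/-- the closure of a half-strip satisfies the three NON-strict inequalities. -/
theorem closure_sinkHalfStrip_subset :
    closure (sinkHalfStrip xv R s) ⊆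
      {v : ℂ | R / 2 ≤ s * (v.re - xv)} ∩ ({v : ℂ | v.im ≤ R / 2} ∩ {v : ℂ | -(R / 2) ≤ v.im}) :=
  closure_minimal
    (fun v hv =>
      have h1 : R / 2 < s * (v.re - xv) := hv.1
      have h2 : v.im < R / 2 := hv.2.1
      have h3 : -(R / 2) < v.im := hv.2.2
      ⟨h1.le, h2.le, h3.le⟩)
    ((isClosed_le continuous_const (continuous_const.mul (Complex.continuous_re.sub continuous_const))).inter
      ((isClosed_le Complex.continuous_im continuous_const).inter
        (isClosed_le continuous_const Complex.continuous_im)))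

/-- `|s·t| = |t|` for a side sign `s = ±1`. -/
theorem abs_side_mul (hs : s = 1 ∨ s = -1) (t : ℝ) : |s * t| = |t| := by
  rcases hs with rfl | rfl <;> simp

/-- every point of the closed half-strip is FAR: `R/2 ≤ |Re v − xv|`. -/
theorem far_of_mem_closure_sinkHalfStrip (hs : s = 1 ∨ s = -1) {v : ℂ} (hv : v ∈ closure (sinkHalfStrip xv R s)) :
    R / 2 ≤ |v.re - xv| := by
  have h : R / 2 ≤ s * (v.re - xv) := (closure_sinkHalfStrip_subset hv).1
  rw [← abs_side_mul hs (v.re - xv)]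
  exact h.trans (le_abs_self _)

/-- the frontier of an open half-strip lies in `MaxStripBdry` (inner column or a lid). -/
theorem frontier_sinkHalfStrip_subset_bdry (hR : 0 ≤ R) (hs : s = 1 ∨ s = -1) {ζ : ℂ}
    (hζ : ζ ∈ frontier (sinkHalfStrip xv R s)) : MaxStripBdry xv R ζ := by
  have hF := closure_sinkHalfStrip_subset (frontier_subset_closure hζ)
  have hζ' : ζ ∈ closure (sinkHalfStrip xv R s) \ sinkHalfStrip xv R s := isOpen_sinkHalfStrip.frontier_eq ▸ hζ
  have hnot : ¬ (R / 2 < s * (ζ.re - xv) ∧ (ζ.im < R / 2 ∧ -(R / 2) < ζ.im)) := fun h => hζ'.2 h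
  have h1 : R / 2 ≤ s * (ζ.re - xv) := hF.1
  have h2 : ζ.im ≤ R / 2 := hF.2.1
  have h3 : -(R / 2) ≤ ζ.im := hF.2.2
  have habs : |ζ.re - xv| = |s * (ζ.re - xv)| := (abs_side_mul hs _).symm
  have hfar : R / 2 ≤ |ζ.re - xv| := by rw [habs]; exact h1.trans (le_abs_self _)
  have him : |ζ.im| ≤ R / 2 := abs_le.2 ⟨h3, h2⟩
  by_cases hc : R / 2 < s * (ζ.re - xv)
  · -- a lid point
    have hlid : ¬ (ζ.im < R / 2 ∧ -(R / 2) < ζ.im) := fun h => hnot ⟨hc, h⟩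
    right
    refine ⟨hfar, ?_⟩
    rcases not_and_or.1 hlid with h | h
    · have : ζ.im = R / 2 := le_antisymm h2 (not_lt.1 h)
      rw [this, abs_of_nonneg (by linarith)]
    · have : ζ.im = -(R / 2) := le_antisymm (not_lt.1 h) h3
      rw [this, abs_neg, abs_of_nonneg (by linarith)]
  · -- an inner-column point
    left
    refine ⟨?_, him⟩
    have heq : s * (ζ.re - xv) = R / 2 := le_antisymm (not_lt.1 hc) h1
    rw [habs, heq, abs_of_nonneg (by linarith)]

/-- maximum principle on ONE open half-strip. -/
theorem nonpos_on_sinkHalfStrip (hR : 0 ≤ R) (hs : s = 1 ∨ s = -1) {r : ℂ → ℝ}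
    (hharm : ∀ u : ℂ, R / 2 ≤ |u.re - xv| → HarmonicAt r u)
    (hdec : Tendsto r (cocompact ℂ) (𝓝 0))
    (hb : ∀ u : ℂ, MaxStripBdry xv R u → r u ≤ 0) :
    ∀ u ∈ sinkHalfStrip xv R s, r u ≤ 0 := by
  have hf : HarmonicOnNhd r (sinkHalfStrip xv R s) := fun v hv =>
    hharm v (far_of_mem_closure_sinkHalfStrip hs (subset_closure hv))
  refine Literature.Analysis.Complex.harmonic_le_of_frontier_of_cocompact isOpen_sinkHalfStrip
    (convex_sinkHalfStrip hs).isPreconnected hf (M := 0) ?_ ?_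
  · intro ζ hζ ε hε
    have hcont : ContinuousAt r ζ :=
      (hharm ζ (far_of_mem_closure_sinkHalfStrip hs (frontier_subset_closure hζ))).1.continuousAt
    have hlt : r ζ < 0 + ε := by linarith [hb ζ (frontier_sinkHalfStrip_subset_bdry hR hs hζ)]
    exact (Filter.Tendsto.eventually_le_const hlt hcont.tendsto).filter_mono nhdsWithin_le_nhds
  · intro ε hε
    have hlt : (0 : ℝ) < 0 + ε := by linarith
    exact (Filter.Tendsto.eventually_le_const hlt hdec).filter_mono inf_le_left

/-- **maximum principle on the maximal far strip**: harmonic at every far point, `→ 0` at infinity,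
`≤ 0` on `MaxStripBdry` ⟹ `≤ 0` on `MaxStrip`. -/
theorem nonpos_on_maxStrip (hR : 0 ≤ R) {r : ℂ → ℝ}
    (hharm : ∀ u : ℂ, R / 2 ≤ |u.re - xv| → HarmonicAt r u)
    (hdec : Tendsto r (cocompact ℂ) (𝓝 0))
    (hb : ∀ u : ℂ, MaxStripBdry xv R u → r u ≤ 0) :
    ∀ u : ℂ, MaxStrip xv R u → r u ≤ 0 := by
  intro u hu
  rcases hu with ⟨hre, him⟩
  by_cases hb1 : |u.re - xv| = R / 2
  · exact hb u (Or.inl ⟨hb1, him⟩)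
  by_cases hb2 : |u.im| = R / 2
  · exact hb u (Or.inr ⟨hre, hb2⟩)
  have hre' : R / 2 < |u.re - xv| := lt_of_le_of_ne hre (Ne.symm hb1)
  have him' : |u.im| < R / 2 := lt_of_le_of_ne him hb2
  have him2 := abs_lt.1 him'
  rcases le_or_gt 0 (u.re - xv) with h0 | h0
  · have hmem : u ∈ sinkHalfStrip xv R 1 := by
      simp only [sinkHalfStrip, Set.mem_inter_iff, Set.mem_setOf_eq]
      refine ⟨?_, ?_, ?_⟩ <;> linarith [abs_of_nonneg h0, him2.1, him2.2]
    exact nonpos_on_sinkHalfStrip hR (Or.inl rfl) hharm hdec hb u hmem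
  · have hmem : u ∈ sinkHalfStrip xv R (-1) := by
      simp only [sinkHalfStrip, Set.mem_inter_iff, Set.mem_setOf_eq]
      refine ⟨?_, ?_, ?_⟩ <;> linarith [abs_of_neg h0, him2.1, him2.2]
    exact nonpos_on_sinkHalfStrip hR (Or.inr rfl) hharm hdec hb u hmem

variable {κ : Type} [Fintype κ]

/-! ## §2  The analytic generator of `cutNumer − σ·farPairC` -/

/-- the analytic GENERATOR: `N(u) − σ·c(u) = Re (sinkGen cs w σ u)` (`cutNumer_sub_eq`).  The conjugate-pole terms are
rewritten through `c·(z − ū)⁻¹ = conj (c̄·(z̄ − u)⁻¹)`, so every term is `const · (q − u)⁻¹` with `q ∈ {w, w̄, p_k, p̄_k}`. -/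
def sinkGen (cs : κ → Cut) (w : ℂ) (σ : ℝ) (u : ℂ) : ℂ :=
  (∑ k, ((cs k).y : ℂ) * (conj (cs k).e * ((w - u)⁻¹ - ((cs k).p - u)⁻¹)
      + (cs k).e * ((conj w - u)⁻¹ - (conj (cs k).p - u)⁻¹)))
    + I * σ * ((conj w - u)⁻¹ - (w - u)⁻¹)

/-- the real-part identity, valid at EVERY `u` (both sides use `0⁻¹ = 0` at the poles). -/
theorem cutNumer_sub_eq (cs : κ → Cut) (w : ℂ) (σ : ℝ) (u : ℂ) :
    cutNumer cs w u - σ * farPairC w u = (sinkGen cs w σ u).re := by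
  have L0 : ∀ c z : ℂ, c * (z - conj u)⁻¹ = conj (conj c * (conj z - u)⁻¹) := by
    intro c z; simp [map_mul, map_sub, map_inv₀]
  have L1 : ∀ c z : ℂ, (c * (z - conj u)⁻¹).re = (conj c * (conj z - u)⁻¹).re := by
    intro c z; rw [L0, Complex.conj_re]
  have L2 : ∀ z : ℂ, ((z - conj u)⁻¹).im = -((conj z - u)⁻¹).im := by
    intro z
    have h := L0 1 z
    rw [one_mul, map_one, one_mul] at h
    rw [h, Complex.conj_im]
  have E1 : ∀ k, (cs k).y * (conj (cs k).e * (farPairK u w - farPairK u (cs k).p)).re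
      = (((cs k).y : ℂ) * (conj (cs k).e * ((w - u)⁻¹ - ((cs k).p - u)⁻¹)
          + (cs k).e * ((conj w - u)⁻¹ - (conj (cs k).p - u)⁻¹))).re := by
    intro k
    have h1 := L1 (conj (cs k).e) w
    have h2 := L1 (conj (cs k).e) (cs k).p
    rw [Complex.conj_conj] at h1 h2
    have hx : conj (cs k).e * (farPairK u w - farPairK u (cs k).p)
        = conj (cs k).e * ((w - u)⁻¹ - ((cs k).p - u)⁻¹)
          + (conj (cs k).e * (w - conj u)⁻¹ - conj (cs k).e * ((cs k).p - conj u)⁻¹) := by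
      simp only [farPairK, one_div]; ring
    rw [Complex.re_ofReal_mul, hx]
    simp only [Complex.add_re, Complex.sub_re, mul_sub, h1, h2]
  have E2 : -(σ * farPairC w u) = (I * σ * ((conj w - u)⁻¹ - (w - u)⁻¹)).re := by
    rw [farPairC, farPairK, one_div, one_div, Complex.add_im, L2 w]
    simp only [Complex.mul_re, Complex.mul_im, Complex.I_re, Complex.I_im, Complex.ofReal_re,
      Complex.ofReal_im, Complex.sub_re, Complex.sub_im]
    ring
  calc cutNumer cs w u - σ * farPairC w u
      = (∑ k, (cs k).y * (conj (cs k).e * (farPairK u w - farPairK u (cs k).p)).re) + -(σ * farPairC w u) := by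
        rw [cutNumer, sub_eq_add_neg]
    _ = (∑ k, (((cs k).y : ℂ) * (conj (cs k).e * ((w - u)⁻¹ - ((cs k).p - u)⁻¹)
          + (cs k).e * ((conj w - u)⁻¹ - (conj (cs k).p - u)⁻¹))).re)
          + (I * σ * ((conj w - u)⁻¹ - (w - u)⁻¹)).re := by
        rw [E2, Finset.sum_congr rfl fun k _ => E1 k]
    _ = (sinkGen cs w σ u).re := by rw [sinkGen, Complex.add_re, Complex.re_sum]

/-- complex differentiability off the poles. -/
theorem sinkGen_differentiableAt (cs : κ → Cut) (w : ℂ) (σ : ℝ) {v : ℂ}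
    (hw : v ≠ w) (hw' : v ≠ conj w) (hp : ∀ k, v ≠ (cs k).p) (hp' : ∀ k, v ≠ conj (cs k).p) :
    DifferentiableAt ℂ (sinkGen cs w σ) v := by
  have hinv : ∀ z : ℂ, v ≠ z → DifferentiableAt ℂ (fun u : ℂ => (z - u)⁻¹) v := fun z hz =>
    ((differentiableAt_const z).fun_sub differentiableAt_fun_id).fun_inv (sub_ne_zero.2 (Ne.symm hz))
  have h1 : ∀ k, DifferentiableAt ℂ (fun u : ℂ => ((cs k).y : ℂ) *
      (conj (cs k).e * ((w - u)⁻¹ - ((cs k).p - u)⁻¹)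
        + (cs k).e * ((conj w - u)⁻¹ - (conj (cs k).p - u)⁻¹))) v := fun k =>
    (differentiableAt_const _).fun_mul
      (((differentiableAt_const _).fun_mul ((hinv w hw).fun_sub (hinv _ (hp k)))).fun_add
        ((differentiableAt_const _).fun_mul ((hinv _ hw').fun_sub (hinv _ (hp' k)))))
  have h2 : DifferentiableAt ℂ (fun u : ℂ => I * σ * ((conj w - u)⁻¹ - (w - u)⁻¹)) v :=
    (differentiableAt_const _).fun_mul ((hinv _ hw').fun_sub (hinv w hw))
  exact (DifferentiableAt.fun_sum (u := Finset.univ) fun k _ => h1 k).fun_add h2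

/-- analyticity at every FAR point (`R/2 ≤ |Re v − xv|`), the poles being strictly inside the near window. -/
theorem sinkGen_analyticAt (cs : κ → Cut) (w : ℂ) (σ : ℝ) {xv R : ℝ}
    (hw : |w.re - xv| < R / 2) (hp : ∀ k, |(cs k).p.re - xv| < R / 2)
    {v : ℂ} (hv : R / 2 ≤ |v.re - xv|) : AnalyticAt ℂ (sinkGen cs w σ) v := by
  have hne : ∀ z : ℂ, |z.re - xv| < R / 2 → v ≠ z ∧ v ≠ conj z := by
    intro z hz
    constructor
    · rintro rfl; linarith
    · rintro rfl; rw [Complex.conj_re] at hv; linarith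
  rw [Complex.analyticAt_iff_eventually_differentiableAt]
  have e1 : ∀ᶠ v' in 𝓝 v, v' ≠ w := eventually_ne_nhds (hne w hw).1
  have e2 : ∀ᶠ v' in 𝓝 v, v' ≠ conj w := eventually_ne_nhds (hne w hw).2
  have e3 : ∀ᶠ v' in 𝓝 v, ∀ k, v' ≠ (cs k).p :=
    eventually_all.2 fun k => eventually_ne_nhds (hne _ (hp k)).1
  have e4 : ∀ᶠ v' in 𝓝 v, ∀ k, v' ≠ conj (cs k).p :=
    eventually_all.2 fun k => eventually_ne_nhds (hne _ (hp k)).2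
  filter_upwards [e1, e2, e3, e4] with v' h1 h2 h3 h4
  exact sinkGen_differentiableAt cs w σ h1 h2 h3 h4

/-- decay at infinity. -/
theorem sinkGen_tendsto (cs : κ → Cut) (w : ℂ) (σ : ℝ) :
    Tendsto (sinkGen cs w σ) (cocompact ℂ) (𝓝 0) := by
  have hq : ∀ z : ℂ, Tendsto (fun u : ℂ => (z - u)⁻¹) (cocompact ℂ) (𝓝 0) := by
    intro z
    rw [← Metric.cobounded_eq_cocompact]
    exact Filter.tendsto_inv₀_cobounded.comp (tendsto_const_sub_cobounded z)
  have hd : ∀ z z' : ℂ, Tendsto (fun u : ℂ => (z - u)⁻¹ - (z' - u)⁻¹) (cocompact ℂ) (𝓝 0) := by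
    intro z z'; simpa using (hq z).sub (hq z')
  have h1 : ∀ k, Tendsto (fun u : ℂ => ((cs k).y : ℂ) *
      (conj (cs k).e * ((w - u)⁻¹ - ((cs k).p - u)⁻¹)
        + (cs k).e * ((conj w - u)⁻¹ - (conj (cs k).p - u)⁻¹))) (cocompact ℂ) (𝓝 0) := by
    intro k
    simpa using ((((hd w (cs k).p).const_mul (conj (cs k).e)).add
      ((hd (conj w) (conj (cs k).p)).const_mul (cs k).e)).const_mul ((cs k).y : ℂ))
  have h2 : Tendsto (fun u : ℂ => I * σ * ((conj w - u)⁻¹ - (w - u)⁻¹)) (cocompact ℂ) (𝓝 0) := by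
    simpa using (hd (conj w) w).const_mul (I * σ)
  have h := (tendsto_finsetSum Finset.univ fun k _ => h1 k).add h2
  simp only [Finset.sum_const_zero, add_zero] at h
  exact h


/-! ## §3  LEMMA H = `RhW08.SinkTemplate.LemmaHSig` -/

/-- **LEMMA H** (C3 memo §2): boundary kernel domination implies kernel domination on the whole maximal far strip,
for every real `σ`, all real weights and directions, every finite cut family — harmonic bookkeeping, not a law. -/
theorem sinkLemmaH : LemmaHSig := by
  intro κ _ xv R cs w σ hw hp hB u hu
  have hR : 0 ≤ R := by linarith [abs_nonneg (w.re - xv)]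
  obtain ⟨r, hr⟩ : ∃ r : ℂ → ℝ, r = fun v => (sinkGen cs w σ v).re := ⟨_, rfl⟩
  have hrv : ∀ v : ℂ, r v = cutNumer cs w v - σ * farPairC w v := fun v => by
    rw [hr, cutNumer_sub_eq]
  have hharm : ∀ v : ℂ, R / 2 ≤ |v.re - xv| → HarmonicAt r v := fun v hv => by
    rw [hr]; exact (sinkGen_analyticAt cs w σ hw hp hv).harmonicAt_re
  have hdec : Tendsto r (cocompact ℂ) (𝓝 0) := by
    have h : Tendsto (fun v => (sinkGen cs w σ v).re) (cocompact ℂ) (𝓝 (0 : ℂ).re) :=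
      (Complex.continuous_re.tendsto 0).comp (sinkGen_tendsto cs w σ)
    rw [Complex.zero_re] at h
    rw [hr]; exact h
  have hb : ∀ v : ℂ, MaxStripBdry xv R v → r v ≤ 0 := fun v hv => by
    rw [hrv]; linarith [hB v hv]
  have key := nonpos_on_maxStrip hR hharm hdec hb u hu
  rw [hrv] at key
  linarith

end RhW08.SinkLemmaH
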